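import Literature.Analysis.InnerProduct.SecularExcess
import Summits.RiemannHypothesis.RiemannHypothesis.Theorems.PfPersistenceIntruderShadowMulti
import HarnessLib

/-!
# PF-persistence THEORY 3 (gen 6) — the ARRIVAL LAW (the size of the intruder eigenvalue is the
# capacitance excess times a scale of the remainder) and the COMPLETE SPLIT (the positivity premise
# of the driver laws, re-typed as "the unlisted drivers are jointly sub-critical")
# (publication cell `pub-rhpf`, theory seat 3)

Framing (page 1 of every `pub-rhpf` file): **mechanism/rigidity campaign — nothing here is a claim
about RH.** Everything in this file is PROVED abstract linear algebra or a DEFINITION; no statement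
about `ζ` or about any control family is made; every empirical sentence in the docstrings is labelled
DATA and refers to `run/shared/lean/pub/pub-rhpf/pub-rhpf-theory-3/THEORY-INTRUDER.md` §11.

Setting (continuing `PfPersistenceIntruderShadow` / `…ShadowMulti`): `E` a real inner product space
(the even cosine sector of a windowed form at cutoff `λ = e^a`, truncation `N`), `T : E →ₗ[ℝ] E` the
form's Galerkin operator, `S : OffLineSplit T` a split `T = A − |v⟩⟨v|` with `A ≥ 0` (one driver;
`v = 2d`, `d` the Im-profile of an off-line zero quadruple) or `S : OffLineSplitN T ι` a split
`T = B − ∑ᵢ |vᵢ⟩⟨vᵢ|` with `B ≥ 0`; `I : Intruder T` a unit eigenvector with eigenvalue `I.eig < 0`;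
`z` a witness `A z = v` and `s := ⟪v, z⟫` (`= vᵀA⁻¹v = 4 dᵀA⁻¹d`, the CAPACITANCE; gen 3:
an intruder exists iff `s > 1`); `y` the resolvent vector `A y + |ε| y = v`.

1. ARRIVAL LAW (tree file `Literature/Analysis/InnerProduct/SecularExcess.lean`, read on a split):
   * `one_lt_secular`                 — a window with an intruder has `s > 1` (gen 3, restated);
   * `negEig_le_excess_mul_rayleigh`  — `|ε| ≤ (s − 1) · ⟪A u, u⟫` (`u` the intruder), hence
     `negEig_le_mul_excess`: `|ε| ≤ Λ (s − 1)` for any form bound `⟪A x, x⟫ ≤ Λ ‖x‖²`;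
   * `excess_eq`                      — the EXCESS IDENTITY `s − 1 = |ε| · ⟪y, z⟫`;
   * `negEig_two_sided`               — `|ε| ‖y‖² ≤ s − 1 ≤ |ε| ‖z‖²`, i.e.
     `(s − 1)/‖A⁻¹v‖² ≤ |ε| ≤ (s − 1)/‖(A + |ε|)⁻¹v‖²`; `negEig_le_excess_mul_sq_moment`:
     `|ε| ≤ (s − 1) ⟪v, u⟫²`; `mul_excess_le_negEig`: `β (s − 1) ≤ |ε|` for any coercivity bound
     `β ‖x‖² ≤ ⟪A x, x⟫`, `β ≥ 0`.
   Reading (PROVED): the negative eigenvalue is BORN CONTINUOUSLY at the capacitance crossing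
   `s(a) = 1`, linearly in the excess `s − 1`, with a slope that is a scale of the REMAINDER `A`
   between `λ_min(A)` and `‖A‖` — so a remainder with a tiny bottom rung seen by the driver produces
   a tiny first negative eigenvalue; nothing in the size of `ε₁` just past `a*` is arithmetic beyond the
   two scalars `s(a)` and "which rung of `A` the shadow occupies" (DATA §11.2: on the DH ladder all
   four bounds hold at the five negative windows; at the onset window (1.72, 430) they pin
   `lg|ε₁| = −29.08` within `[−29.98, −28.57]`).
2. SUB-CRITICAL SANDWICH: `form_ge_defect_mul` — `(1 − s) ⟪A x, x⟫ ≤ ⟪T x, x⟫` for every `x`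
   (`(1 − s) A ≤ T ≤ A`); `form_ge_defect_mul_of_coercive`; and jointly for several drivers
   `formN_ge_of_capacitance_le` — if the capacitance matrix `Vᵀ B⁻¹ V ≤ θ` then `(1 − θ) B ≤ T`.
   Reading (PROVED): before the crossing the window INHERITS positivity from the remainder with the
   explicit loss factor `1 − s(a)`; "no intruder" is quantitative.
3. COMPLETE SPLIT and the EXCLUDED-DRIVER CRITERION (re-typing the DATA premise `B ≥ 0` of gens 3–5):
   * `rankOneSum c` (`x ↦ ∑ₖ ⟪cₖ, x⟫ cₖ`, symmetric, form `∑ₖ ⟪cₖ, x⟫² ≥ 0`) and `completeSplit` — if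
     `T x = ∑ₖ ⟪cₖ, x⟫ cₖ + P x − ∑ᵢ ⟪vᵢ, x⟫ vᵢ` with `P` symmetric and form-nonnegative, then
     `T` carries an `OffLineSplitN T ι` with `B = rankOneSum c + P`, and `B ≥ 0` is AUTOMATIC (a sum
     of squares plus `P`): when EVERY off-line driver is listed, the driver laws (negative index
     `≤ #ι`, capacitance count, resolvent shadow, secular system, arrival law) hold WITHOUT a
     positivity premise.
   * `partialRemainder`, `excludedSplit`, `partialRemainder_nonneg_iff`, `restrict` — for a split over
     `ι ⊕ κ` (listed drivers `ι`, further drivers `κ`), the remainder a split over `ι` ALONE would use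
     is `B_ι = B − ∑_{j ∈ κ} |v_j⟩⟨v_j|` (`= T + ∑_{i ∈ ι} |v_i⟩⟨v_i|`), and (Haynsworth, tree
     `negative_iff_capacitance_negative` applied to the excluded drivers) `B_ι ≥ 0` iff the
     capacitance form of the EXCLUDED drivers against the full remainder, `I − V_κᵀ B⁻¹ V_κ`, takes no
     negative value; when it holds, `restrict` is the `OffLineSplitN T ι` of gens 3–5.
   Reading (PROVED ⟹ re-labelling, no number changes): the premise "`B_m(a, N) ≥ 0`" of TH3-N2/N3
   (DATA: Arb / ball PD-certificates per window) is EQUIVALENT to "the off-line zeros NOT among the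
   `m` listed drivers are jointly sub-critical at `(a, N)` against the complete remainder"; for a
   family with finitely many off-line quadruples all listed (the planted controls, whose complete
   remainder is `Q_ζ(a, N) + 4m |r⟩⟨r|`, nonnegative on every served window where `Q_ζ(a, N) ≥ 0` is
   certified) no premise remains.  The dictionary (which vectors are `cₖ`, `vᵢ`, what `P` is) is the
   explicit formula, THEORY-INTRUDER §9.1 (D6) — CITED there, not formalised here.

Don't-look sentence (RULING A24 k4): every statement here holds for ANY symmetric window admitting
such a split — Davenport–Heilbronn, Epstein, planted controls alike; nothing in this file separates
`ζ` (no intruder on any served window) from a control, and `ι = ∅` for `ζ` would be the RH-shaped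
statement the cell does not make.

## References
* G. H. Golub, C. F. Van Loan, *Matrix Computations*, 4th ed. (2013), §8.4.3, Thm 8.4.3. [GolubVanLoan2013]
* E. V. Haynsworth, Linear Algebra Appl. 1 (1968) 73–81. [Haynsworth1968]
* R. A. Horn, C. R. Johnson, *Matrix Analysis*, 2nd ed. (2013), Thm 7.7.7. [HornJohnson2013]
* P. Arbenz, G. H. Golub, SIAM J. Matrix Anal. Appl. 9 (1988) 40–58. [ArbenzGolub1988]
-/

noncomputable section

open scoped InnerProductSpace BigOperators

set_option linter.dupNamespace false

namespace Summit.RiemannHypothesis.RiemannHypothesis.Theorems.PfPersistenceIntruderArrival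

open Literature.Analysis.InnerProduct
open Summit.RiemannHypothesis.RiemannHypothesis.Theorems.PfPersistenceIntruderOrthogonality (Intruder)
open Summit.RiemannHypothesis.RiemannHypothesis.Theorems.PfPersistenceIntruderShadow (OffLineSplit)
open Summit.RiemannHypothesis.RiemannHypothesis.Theorems.PfPersistenceIntruderShadowMulti (OffLineSplitN)

variable {E : Type*} [NormedAddCommGroup E] [InnerProductSpace ℝ E]

/-- A unit vector is nonzero. [folklore] -/
theorem Intruder.vec_ne_zero {T : E →ₗ[ℝ] E} (I : Intruder T) : I.vec ≠ 0 := by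
  intro h; have := I.norm_eq; rw [h, norm_zero] at this; exact zero_ne_one this

/-- A unit vector has `⟪u, u⟫ = 1`. [folklore] -/
theorem Intruder.inner_self {T : E →ₗ[ℝ] E} (I : Intruder T) : ⟪I.vec, I.vec⟫_ℝ = 1 := by
  rw [real_inner_self_eq_norm_sq, I.norm_eq]; norm_num

/-! ## 1. The arrival law on a single-driver split -/

section SingleDriver

variable {T : E →ₗ[ℝ] E} (S : OffLineSplit T)

/-- A window with an intruder is past the crossing: `1 < ⟪v, z⟫ = vᵀA⁻¹v` for every witness
`A z = v` (gen 3's `negative_iff_secular_gt_one`, instantiated at the intruder). [folklore] -/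
theorem one_lt_secular (I : Intruder T) {z : E} (hz : S.A z = S.v) : 1 < ⟪S.v, z⟫_ℝ := by
  refine (S.negative_iff_secular_gt_one hz).mp ⟨I.vec, ?_⟩
  rw [I.apply_eq, real_inner_smul_left, Intruder.inner_self, mul_one]
  exact I.eig_neg

/-- **Arrival law, Rayleigh form**: `|ε| ≤ (s − 1) · ⟪A u, u⟫` for the intruder `u` and any witness
`A z = v`, `s = ⟪v, z⟫` (tree `rankOne_downdate_eig_mul_inner_le`). [cite: GolubVanLoan2013, Thm 8.4.3] -/
theorem negEig_le_excess_mul_rayleigh (I : Intruder T) {z : E} (hz : S.A z = S.v) :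
    -I.eig ≤ (⟪S.v, z⟫_ℝ - 1) * ⟪S.A I.vec, I.vec⟫_ℝ := by
  have h := rankOne_downdate_eig_mul_inner_le S.A S.A_symm S.A_nonneg (S.intruder_eq I) hz
  rwa [Intruder.inner_self, mul_one] at h

/-- **Arrival law, upper bound by the top of the remainder**: if `⟪A x, x⟫ ≤ Λ ⟪x, x⟫` for all `x`
then `|ε| ≤ Λ (s − 1)` (tree `rankOne_downdate_eig_le_mul_excess`). [cite: GolubVanLoan2013, Thm 8.4.3] -/
theorem negEig_le_mul_excess (I : Intruder T) {z : E} (hz : S.A z = S.v) {Λ : ℝ}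
    (hΛ : ∀ x : E, ⟪S.A x, x⟫_ℝ ≤ Λ * ⟪x, x⟫_ℝ) : -I.eig ≤ Λ * (⟪S.v, z⟫_ℝ - 1) :=
  rankOne_downdate_eig_le_mul_excess S.A S.A_symm S.A_nonneg (neg_pos.mpr I.eig_neg)
    (Intruder.vec_ne_zero I) (S.intruder_eq I) hz hΛ

/-- **Excess identity**: with the resolvent vector `A y + |ε| y = v` and a witness `A z = v`,
`s − 1 = |ε| · ⟪y, z⟫` (`4dᵀA⁻¹d − 1 = |ε| · vᵀ(A + |ε|)⁻¹A⁻¹v`; tree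
`rankOne_downdate_secular_excess_eq`). [cite: GolubVanLoan2013, Thm 8.4.3] -/
theorem excess_eq (I : Intruder T) {y z : E} (hy : S.A y + (-I.eig) • y = S.v) (hz : S.A z = S.v) :
    ⟪S.v, z⟫_ℝ - 1 = (-I.eig) * ⟪y, z⟫_ℝ :=
  rankOne_downdate_secular_excess_eq S.A S.A_symm S.A_nonneg (neg_pos.mpr I.eig_neg)
    (Intruder.vec_ne_zero I) (S.intruder_eq I) hy hz

/-- **Arrival law, two-sided**: `|ε| ‖y‖² ≤ s − 1 ≤ |ε| ‖z‖²`, i.e.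
`(s − 1)/‖A⁻¹v‖² ≤ |ε| ≤ (s − 1)/‖(A + |ε|)⁻¹v‖²` — the negative eigenvalue is born continuously at
the crossing `s = 1`, linearly in the excess (tree `rankOne_downdate_eig_two_sided`).
[cite: GolubVanLoan2013, Thm 8.4.3] -/
theorem negEig_two_sided (I : Intruder T) {y z : E} (hy : S.A y + (-I.eig) • y = S.v)
    (hz : S.A z = S.v) :
    (-I.eig) * ⟪y, y⟫_ℝ ≤ ⟪S.v, z⟫_ℝ - 1 ∧ ⟪S.v, z⟫_ℝ - 1 ≤ (-I.eig) * ⟪z, z⟫_ℝ :=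
  rankOne_downdate_eig_two_sided S.A S.A_symm S.A_nonneg (neg_pos.mpr I.eig_neg)
    (Intruder.vec_ne_zero I) (S.intruder_eq I) hy hz

/-- The upper half in terms of the intruder's moment against the driver: `|ε| ≤ (s − 1) · ⟪v, u⟫²`
(tree `rankOne_downdate_eig_le_excess_mul_sq_moment`). [cite: GolubVanLoan2013, Thm 8.4.3] -/
theorem negEig_le_excess_mul_sq_moment (I : Intruder T) {y z : E}
    (hy : S.A y + (-I.eig) • y = S.v) (hz : S.A z = S.v) :
    -I.eig ≤ (⟪S.v, z⟫_ℝ - 1) * ⟪S.v, I.vec⟫_ℝ ^ 2 :=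
  rankOne_downdate_eig_le_excess_mul_sq_moment S.A S.A_symm S.A_nonneg (neg_pos.mpr I.eig_neg)
    I.norm_eq (S.intruder_eq I) hy hz

/-- **Arrival law, lower bound by the bottom of the remainder**: if `0 ≤ β` and
`β ⟪x, x⟫ ≤ ⟪A x, x⟫` for all `x` then `β (s − 1) ≤ |ε|` (tree `rankOne_downdate_mul_excess_le_eig`).
[cite: GolubVanLoan2013, Thm 8.4.3] -/
theorem mul_excess_le_negEig (I : Intruder T) {y z : E} (hy : S.A y + (-I.eig) • y = S.v)
    (hz : S.A z = S.v) {β : ℝ} (hβ0 : 0 ≤ β) (hβ : ∀ x : E, β * ⟪x, x⟫_ℝ ≤ ⟪S.A x, x⟫_ℝ) :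
    β * (⟪S.v, z⟫_ℝ - 1) ≤ -I.eig :=
  rankOne_downdate_mul_excess_le_eig S.A S.A_symm S.A_nonneg (neg_pos.mpr I.eig_neg)
    (Intruder.vec_ne_zero I) (S.intruder_eq I) hy hz hβ0 hβ

/-! ## 2. The sub-critical sandwich -/

/-- **Sub-critical sandwich**: with a witness `A z = v`, `(1 − ⟪v, z⟫) ⟪A x, x⟫ ≤ ⟪T x, x⟫` for every
`x`; before the crossing (`s < 1`) the window form dominates `(1 − s) A ≥ 0` (tree
`rankOne_downdate_form_ge`). [cite: HornJohnson2013, Thm 7.7.7] -/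
theorem form_ge_defect_mul {z : E} (hz : S.A z = S.v) (x : E) :
    (1 - ⟪S.v, z⟫_ℝ) * ⟪S.A x, x⟫_ℝ ≤ ⟪T x, x⟫_ℝ := by
  rw [S.inner_apply_self]
  exact rankOne_downdate_form_ge S.A S.A_symm S.A_nonneg hz x

/-- Coercive form of the sandwich: if `β ⟪x, x⟫ ≤ ⟪A x, x⟫` for all `x` and `s ≤ 1` then
`(1 − s) β ‖x‖² ≤ ⟪T x, x⟫`: the bottom of the window is at least `(1 − s) λ_min(A)` (tree
`rankOne_downdate_form_ge_of_coercive`). [cite: HornJohnson2013, Thm 7.7.7] -/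
theorem form_ge_defect_mul_of_coercive {z : E} (hz : S.A z = S.v) {β : ℝ}
    (hβ : ∀ x : E, β * ⟪x, x⟫_ℝ ≤ ⟪S.A x, x⟫_ℝ) (hs : ⟪S.v, z⟫_ℝ ≤ 1) (x : E) :
    (1 - ⟪S.v, z⟫_ℝ) * (β * ⟪x, x⟫_ℝ) ≤ ⟪T x, x⟫_ℝ := by
  rw [S.inner_apply_self]
  exact rankOne_downdate_form_ge_of_coercive S.A S.A_symm S.A_nonneg hz hβ hs x

end SingleDriver

section MultiDriver

variable {ι : Type*} [Fintype ι]
variable {T : E →ₗ[ℝ] E}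

/-- **Multi-driver sandwich**: if `B zᵢ = vᵢ`, `0 ≤ θ` and the capacitance matrix is bounded by `θ`
(`∑ᵢ∑ⱼ cᵢ cⱼ ⟪vᵢ, zⱼ⟫ ≤ θ ∑ᵢ cᵢ²` for all `c`, i.e. `Vᵀ B⁻¹ V ≤ θ`), then
`(1 − θ) ⟪B x, x⟫ ≤ ⟪T x, x⟫` for every `x`: jointly sub-critical drivers (`θ < 1`) leave the window
bounded below by `(1 − θ) B ≥ 0` (tree `finiteRank_downdate_form_ge`).
[cite: Haynsworth1968, inertia additivity formula] -/
theorem formN_ge_of_capacitance_le (S : OffLineSplitN T ι) (z : ι → E) (hz : ∀ i, S.B (z i) = S.v i)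
    {θ : ℝ} (hθ : 0 ≤ θ)
    (hcap : ∀ c : ι → ℝ, ∑ i, ∑ j, c i * c j * ⟪S.v i, z j⟫_ℝ ≤ θ * ∑ i, c i ^ 2) (x : E) :
    (1 - θ) * ⟪S.B x, x⟫_ℝ ≤ ⟪T x, x⟫_ℝ := by
  rw [S.inner_apply_self]
  exact finiteRank_downdate_form_ge S.B S.B_symm S.B_nonneg S.v z hz hθ hcap x

end MultiDriver

/-! ## 3. The complete split and the excluded-driver criterion -/

section CompleteSplit

variable {ι : Type*} [Fintype ι] {κ : Type*} [Fintype κ]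

/-- The finite sum of rank-one projectors `x ↦ ∑ₖ ⟪cₖ, x⟫ cₖ` (`C Cᵀ` for the column family `c`).
[folklore] -/
def rankOneSum (c : κ → E) : E →ₗ[ℝ] E where
  toFun x := ∑ k, ⟪c k, x⟫_ℝ • c k
  map_add' x y := by
    simp only [inner_add_right, add_smul, Finset.sum_add_distrib]
  map_smul' r x := by
    simp only [real_inner_smul_right, RingHom.id_apply, Finset.smul_sum, smul_smul]

/-- Unfolding `rankOneSum`. [folklore] -/
@[simp] theorem rankOneSum_apply (c : κ → E) (x : E) :
    rankOneSum c x = ∑ k, ⟪c k, x⟫_ℝ • c k := rfl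

/-- `⟪C Cᵀ x, y⟫ = ∑ₖ ⟪cₖ, x⟫ ⟪cₖ, y⟫`. [folklore] -/
theorem inner_rankOneSum_left (c : κ → E) (x y : E) :
    ⟪rankOneSum c x, y⟫_ℝ = ∑ k, ⟪c k, x⟫_ℝ * ⟪c k, y⟫_ℝ := by
  simp only [rankOneSum_apply, sum_inner, real_inner_smul_left]

/-- `⟪x, C Cᵀ y⟫ = ∑ₖ ⟪cₖ, x⟫ ⟪cₖ, y⟫`. [folklore] -/
theorem inner_rankOneSum_right (c : κ → E) (x y : E) :
    ⟪x, rankOneSum c y⟫_ℝ = ∑ k, ⟪c k, x⟫_ℝ * ⟪c k, y⟫_ℝ := by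
  simp only [rankOneSum_apply, inner_sum, real_inner_smul_right]
  exact Finset.sum_congr rfl fun k _ => by rw [real_inner_comm (c k) x]; ring

/-- `C Cᵀ` is symmetric. [folklore] -/
theorem rankOneSum_symm (c : κ → E) (x y : E) :
    ⟪rankOneSum c x, y⟫_ℝ = ⟪x, rankOneSum c y⟫_ℝ := by
  rw [inner_rankOneSum_left, inner_rankOneSum_right]

/-- `⟪C Cᵀ x, x⟫ = ∑ₖ ⟪cₖ, x⟫² ≥ 0`: a sum of squares. [folklore] -/
theorem inner_rankOneSum_self (c : κ → E) (x : E) :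
    ⟪rankOneSum c x, x⟫_ℝ = ∑ k, ⟪c k, x⟫_ℝ ^ 2 := by
  rw [inner_rankOneSum_left]
  exact Finset.sum_congr rfl fun k _ => by ring

/-- The form of `C Cᵀ` is nonnegative. [folklore] -/
theorem inner_rankOneSum_self_nonneg (c : κ → E) (x : E) : 0 ≤ ⟪rankOneSum c x, x⟫_ℝ := by
  rw [inner_rankOneSum_self]
  exact Finset.sum_nonneg fun k _ => sq_nonneg _

/-- **The complete split.** If the window operator is a finite sum of squares plus a symmetric
form-nonnegative `P` minus the listed drivers, `T x = ∑ₖ ⟪cₖ, x⟫ cₖ + P x − ∑ᵢ ⟪vᵢ, x⟫ vᵢ`, then it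
carries an `OffLineSplitN T ι` whose remainder `B = C Cᵀ + P` is nonnegative BY CONSTRUCTION — no
positivity premise. (Dictionary, CITED explicit formula, THEORY-INTRUDER §9.1: `cₖ = √2·`(profile of
an on-line zero) or `2·`(Re-profile `r_j` of an off-line quadruple), `vᵢ = 2·`(Im-profile `d_i`), ALL
off-line quadruples listed; `P` = whatever symmetric nonnegative part is kept unresolved.) [folklore] -/
def completeSplit (T : E →ₗ[ℝ] E) (c : κ → E) (P : E →ₗ[ℝ] E)
    (hPsymm : ∀ x y : E, ⟪P x, y⟫_ℝ = ⟪x, P y⟫_ℝ) (hPpos : ∀ x : E, 0 ≤ ⟪P x, x⟫_ℝ) (v : ι → E)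
    (happly : ∀ x : E, T x = (∑ k, ⟪c k, x⟫_ℝ • c k) + P x - ∑ i, ⟪v i, x⟫_ℝ • v i) :
    OffLineSplitN T ι where
  B := rankOneSum c + P
  v := v
  apply_eq x := by rw [happly, LinearMap.add_apply, rankOneSum_apply]
  B_symm x y := by
    rw [LinearMap.add_apply, LinearMap.add_apply, inner_add_left, inner_add_right, rankOneSum_symm,
      hPsymm]
  B_nonneg x := by
    rw [LinearMap.add_apply, inner_add_left]
    exact add_nonneg (inner_rankOneSum_self_nonneg c x) (hPpos x)

/-- The remainder of the complete split is `x ↦ ∑ₖ ⟪cₖ, x⟫ cₖ + P x`. [folklore] -/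
@[simp] theorem completeSplit_B_apply (T : E →ₗ[ℝ] E) (c : κ → E) (P : E →ₗ[ℝ] E)
    (hPsymm : ∀ x y : E, ⟪P x, y⟫_ℝ = ⟪x, P y⟫_ℝ) (hPpos : ∀ x : E, 0 ≤ ⟪P x, x⟫_ℝ) (v : ι → E)
    (happly : ∀ x : E, T x = (∑ k, ⟪c k, x⟫_ℝ • c k) + P x - ∑ i, ⟪v i, x⟫_ℝ • v i) (x : E) :
    (completeSplit T c P hPsymm hPpos v happly).B x = (∑ k, ⟪c k, x⟫_ℝ • c k) + P x := rfl

/-- Under a complete split the negative index of the window is at most the number of off-line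
drivers, with NO positivity premise (gen 4's `negSubspace_finrank_le` on `completeSplit`).
[cite: Haynsworth1968, inertia additivity formula] -/
theorem negSubspace_finrank_le_of_completeSplit (T : E →ₗ[ℝ] E) (c : κ → E) (P : E →ₗ[ℝ] E)
    (hPsymm : ∀ x y : E, ⟪P x, y⟫_ℝ = ⟪x, P y⟫_ℝ) (hPpos : ∀ x : E, 0 ≤ ⟪P x, x⟫_ℝ) (v : ι → E)
    (happly : ∀ x : E, T x = (∑ k, ⟪c k, x⟫_ℝ • c k) + P x - ∑ i, ⟪v i, x⟫_ℝ • v i)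
    (W : Submodule ℝ E) (hW : ∀ x ∈ W, x ≠ 0 → ⟪T x, x⟫_ℝ < 0) :
    Module.finrank ℝ W ≤ Fintype.card ι :=
  (completeSplit T c P hPsymm hPpos v happly).negSubspace_finrank_le W hW

variable {T : E →ₗ[ℝ] E}

/-- The PARTIAL REMAINDER over the listed drivers `ι` of a split over `ι ⊕ κ`:
`B_ι = B − ∑_{j ∈ κ} |v (inr j)⟩⟨v (inr j)|` — the operator a split over `ι` alone would have to use
as its remainder. [folklore] -/
def partialRemainder (S : OffLineSplitN T (ι ⊕ κ)) : E →ₗ[ℝ] E :=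
  S.B - rankOneSum (fun j => S.v (Sum.inr j))

/-- Unfolding `partialRemainder`. [folklore] -/
theorem partialRemainder_apply (S : OffLineSplitN T (ι ⊕ κ)) (x : E) :
    partialRemainder S x = S.B x - ∑ j, ⟪S.v (Sum.inr j), x⟫_ℝ • S.v (Sum.inr j) := rfl

/-- `T = B_ι − ∑_{i ∈ ι} |v (inl i)⟩⟨v (inl i)|`. [folklore] -/
theorem apply_eq_partialRemainder (S : OffLineSplitN T (ι ⊕ κ)) (x : E) :
    T x = partialRemainder S x - ∑ i, ⟪S.v (Sum.inl i), x⟫_ℝ • S.v (Sum.inl i) := by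
  rw [partialRemainder_apply, S.apply_eq, Fintype.sum_sum_type]
  abel

/-- The form of the partial remainder: `⟪B_ι x, x⟫ = ⟪T x, x⟫ + ∑_{i ∈ ι} ⟪v (inl i), x⟫²`.
[folklore] -/
theorem inner_partialRemainder_self (S : OffLineSplitN T (ι ⊕ κ)) (x : E) :
    ⟪partialRemainder S x, x⟫_ℝ = ⟪T x, x⟫_ℝ + ∑ i, ⟪S.v (Sum.inl i), x⟫_ℝ ^ 2 := by
  rw [apply_eq_partialRemainder S x, inner_sub_left, sum_inner]
  have : ∑ i, ⟪⟪S.v (Sum.inl i), x⟫_ℝ • S.v (Sum.inl i), x⟫_ℝ = ∑ i, ⟪S.v (Sum.inl i), x⟫_ℝ ^ 2 :=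
    Finset.sum_congr rfl fun i _ => by rw [real_inner_smul_left, sq]
  rw [this]
  ring

/-- `B_ι` is symmetric. [folklore] -/
theorem partialRemainder_symm (S : OffLineSplitN T (ι ⊕ κ)) (x y : E) :
    ⟪partialRemainder S x, y⟫_ℝ = ⟪x, partialRemainder S y⟫_ℝ := by
  rw [partialRemainder_apply, partialRemainder_apply, ← rankOneSum_apply, ← rankOneSum_apply,
    inner_sub_left, inner_sub_right, S.B_symm, rankOneSum_symm]

/-- The EXCLUDED drivers `κ` form a split of the partial remainder `B_ι` whose remainder is the full
`B ≥ 0`. [folklore] -/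
def excludedSplit (S : OffLineSplitN T (ι ⊕ κ)) : OffLineSplitN (partialRemainder S) κ where
  B := S.B
  v := fun j => S.v (Sum.inr j)
  apply_eq := partialRemainder_apply S
  B_symm := S.B_symm
  B_nonneg := S.B_nonneg

/-- **Excluded-driver criterion.** For a split over `ι ⊕ κ` with witnesses `B zⱼ = v (inr j)`, the
partial remainder over the listed drivers is form-nonnegative iff the capacitance form of the EXCLUDED
drivers against the full remainder, `c ↦ ∑ⱼ cⱼ² − ∑ⱼ∑ⱼ' cⱼ cⱼ' ⟪v (inr j), zⱼ'⟫`
(`I − V_κᵀ B⁻¹ V_κ`), takes no negative value — "`B_ι ≥ 0` ⟺ the unlisted drivers are jointly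
sub-critical" (tree `negative_iff_capacitance_negative` on `excludedSplit`).
[cite: Haynsworth1968, inertia additivity formula; ArbenzGolub1988, capacitance matrix] -/
theorem partialRemainder_nonneg_iff (S : OffLineSplitN T (ι ⊕ κ)) (z : κ → E)
    (hz : ∀ j, S.B (z j) = S.v (Sum.inr j)) :
    (∀ x : E, 0 ≤ ⟪partialRemainder S x, x⟫_ℝ) ↔
      ∀ c : κ → ℝ, 0 ≤ ∑ j, c j ^ 2 - ∑ j, ∑ j', c j * c j' * ⟪S.v (Sum.inr j), z j'⟫_ℝ := by
  have h := (excludedSplit S).negative_iff_capacitance_negative z hz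
  constructor
  · intro hpos c
    by_contra hc
    obtain ⟨x, hx⟩ := h.mpr ⟨c, not_le.mp hc⟩
    exact absurd (hpos x) (not_le.mpr hx)
  · intro hcap x
    by_contra hx
    obtain ⟨c, hc⟩ := h.mp ⟨x, not_le.mp hx⟩
    exact absurd (hcap c) (not_le.mpr hc)

/-- **Re-typing the premise.** When the partial remainder is nonnegative — equivalently
(`partialRemainder_nonneg_iff`) when the excluded drivers are jointly sub-critical — the listed
drivers ALONE form a split of `T`: this is the `OffLineSplitN T ι` (for `#ι = 1`, the `OffLineSplit`)
whose premise `B ≥ 0` gens 3–5 took as per-window DATA. [folklore] -/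
def restrict (S : OffLineSplitN T (ι ⊕ κ)) (hpos : ∀ x : E, 0 ≤ ⟪partialRemainder S x, x⟫_ℝ) :
    OffLineSplitN T ι where
  B := partialRemainder S
  v := fun i => S.v (Sum.inl i)
  apply_eq := apply_eq_partialRemainder S
  B_symm := partialRemainder_symm S
  B_nonneg := hpos

/-- Consequently: if the excluded drivers are jointly sub-critical, the window's negative index is at
most the number of LISTED drivers (gen 4's count on `restrict`). [cite: Haynsworth1968, inertia additivity formula] -/
theorem negSubspace_finrank_le_card_listed (S : OffLineSplitN T (ι ⊕ κ)) (z : κ → E)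
    (hz : ∀ j, S.B (z j) = S.v (Sum.inr j))
    (hcap : ∀ c : κ → ℝ, 0 ≤ ∑ j, c j ^ 2 - ∑ j, ∑ j', c j * c j' * ⟪S.v (Sum.inr j), z j'⟫_ℝ)
    (W : Submodule ℝ E) (hW : ∀ x ∈ W, x ≠ 0 → ⟪T x, x⟫_ℝ < 0) :
    Module.finrank ℝ W ≤ Fintype.card ι :=
  (restrict S ((partialRemainder_nonneg_iff S z hz).mpr hcap)).negSubspace_finrank_le W hW

end CompleteSplit

end Summit.RiemannHypothesis.RiemannHypothesis.Theorems.PfPersistenceIntruderArrival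

end
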